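import Literature.Topology.FourManifolds.SeifertLevelSurface
import Literature.Topology.FourManifolds.RegularLevelSplitting
import Literature.Topology.FourManifolds.RegularDomainMaps
import Literature.Topology.FourManifolds.ImmersionOrientation
import HarnessLib

/-!
# The Seifert surface `K ∪ θ⁻¹{v}` as a regular domain of the closed-up level surface

Topic `Literature/Topology/FourManifolds`; fact seat
`provefact-Literature.Topology.FourManifolds.Knot.sliceGenus_eq_zero_iff`, glue step G3 of the
transversality construction of Seifert surfaces (Juhász, *Differential and Low-Dimensional
Topology* (2023), proof of Prop. 4.10: the regular level "extends in `N(L)` to a compact […]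
manifold with boundary `L`"). Everything here is **proved**.

From `SeifertLevelSurface.lean`: for a Seifert datum `D` of the knot `K` (tube `ν`, circle map
`θ`, regular value `v` with regular antipode) the closed-up level surface
`Λ = K ∪ θ⁻¹{v, -v} ⊆ 𝕊³` is a `C^∞` surface without boundary (`D.Sheet`). Here the half
`Ŝ = K ∪ θ⁻¹{v}` is cut out of `Λ` as the regular sublevel set `{τ ≤ 0}` of a smooth function
`τ : Λ → ℝ` (`SeifertDatum.sideFn`) which is `-sat ⟪w, v⟫` in the unit tube (`sat` a smooth
saturation of the identity, `SeifertDatum`-independent) and `∓1` on the two sheets `θ⁻¹{±v}`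
away from the knot; `0` is a regular value of `τ`, attained exactly on the knot. The tree's
regular-sublevel-set structure for manifolds without boundary (`sublevelAtlas'`,
`RegularLevelSplitting.lean`; Milnor 1963, Thm. 3.1) then makes `Ŝ` a compact `C^∞` surface with
boundary (`D.Surface`, charts in `EuclideanHalfSpace 2`), whose boundary is the knot
(`isBoundaryPoint_iff_mem_range`), smoothly embedded in `Λ`, hence in `𝕊³ ⊆ ℝ⁴` by a smooth
injective immersion `F` equal to `K ∘ e` on `∂Ŝ` for a homeomorphism `e : ∂Ŝ ≃ₜ 𝕊¹`
(`surfaceMap`, `boundaryHomeomorph`) — the data of `Knot.HasSeifertSurfaceOfGenus` except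
connectedness, orientability and the genus, which are supplied in the sibling files.

## References

* A. Juhász, *Differential and Low-Dimensional Topology* (2023), proof of Prop. 4.10.
  [Juhasz2023]
* J. Milnor, *Morse theory* (1963), Thm. 3.1 (regular sublevel sets are manifolds with
  boundary). [Milnor1963]
* J. M. Lee, *Introduction to Smooth Manifolds*, 2nd ed. (2013), Prop. 5.47, Cor. 5.30.
  [LeeSmoothManifolds2013]
-/

open scoped Manifold ContDiff Topology RealInnerProductSpace
open Function Set Filter

noncomputable section

namespace Literature.Topology.FourManifolds

/-- Local notation: `𝔼 n` is the model Euclidean space `EuclideanSpace ℝ (Fin n)`. -/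
local notation "𝔼 " n:arg => EuclideanSpace ℝ (Fin n)

/-- Local notation: `ℍ n` is the model half-space `EuclideanHalfSpace n`. -/
local notation "ℍ " n:arg => EuclideanHalfSpace n

/-- Local notation: `𝕊 n` is the unit sphere in `EuclideanSpace ℝ (Fin (n + 1))`. -/
local notation "𝕊 " n:arg => (Metric.sphere (0 : EuclideanSpace ℝ (Fin (n + 1))) 1)

/-! ### A smooth saturation of the identity -/

/-- **Smooth saturation** `sat : ℝ → ℝ`: the identity on `[-1/2, 1/2]`, `1` on `[3/4, ∞)`,
`-1` on `(-∞, -3/4]`, of the sign of its argument and vanishing only at `0`. [folklore] -/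
def sat (s : ℝ) : ℝ :=
  s + (1 - s) * smoothStep (1 / 2) (3 / 4) s + (-1 - s) * smoothStep (1 / 2) (3 / 4) (-s)

/-- `sat` is smooth. [folklore] -/
theorem contDiff_sat : ContDiff ℝ ∞ sat :=
  (contDiff_id.add ((contDiff_const.sub contDiff_id).mul (contDiff_smoothStep _ _))).add
    ((contDiff_const.sub contDiff_id).mul ((contDiff_smoothStep _ _).comp contDiff_neg))

/-- `sat s = s` for `|s| ≤ 1/2`. [folklore] -/
theorem sat_of_abs_le {s : ℝ} (h : |s| ≤ 1 / 2) : sat s = s := by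
  rw [abs_le] at h
  rw [sat, smoothStep_of_le (by norm_num) h.2, smoothStep_of_le (by norm_num) (by linarith), mul_zero,
    mul_zero, add_zero, add_zero]

/-- `sat s = 1` for `s ≥ 3/4`. [folklore] -/
theorem sat_of_ge {s : ℝ} (h : 3 / 4 ≤ s) : sat s = 1 := by
  rw [sat, smoothStep_of_ge (by norm_num) h, smoothStep_of_le (by norm_num) (by linarith)]; ring

/-- `sat s = -1` for `s ≤ -3/4`. [folklore] -/
theorem sat_of_le {s : ℝ} (h : s ≤ -(3 / 4)) : sat s = -1 := by
  rw [sat, smoothStep_of_le (by norm_num) (by linarith), smoothStep_of_ge (by norm_num) (by linarith)]; ring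

/-- The smooth step is nonnegative. [folklore] -/
theorem smoothStep_nonneg (a b r : ℝ) : 0 ≤ smoothStep a b r := (smoothStep_mem_Icc a b r).1

/-- The smooth step is at most `1`. [folklore] -/
theorem smoothStep_le_one (a b r : ℝ) : smoothStep a b r ≤ 1 := (smoothStep_mem_Icc a b r).2

/-- `sat s > 0` for `s > 0`. [folklore] -/
theorem sat_pos {s : ℝ} (h : 0 < s) : 0 < sat s := by
  rw [sat, smoothStep_of_le (a := 1 / 2) (by norm_num) (by linarith : -s ≤ 1 / 2), mul_zero, add_zero]
  have h0 := smoothStep_nonneg (1 / 2) (3 / 4) s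
  have h1 := smoothStep_le_one (1 / 2) (3 / 4) s
  by_cases hs : s ≤ 1
  · nlinarith
  · rw [smoothStep_of_ge (by norm_num) (by linarith)]; linarith

/-- `sat s < 0` for `s < 0`. [folklore] -/
theorem sat_neg {s : ℝ} (h : s < 0) : sat s < 0 := by
  rw [sat, smoothStep_of_le (a := 1 / 2) (by norm_num) (by linarith : s ≤ 1 / 2), mul_zero, add_zero]
  have h0 := smoothStep_nonneg (1 / 2) (3 / 4) (-s)
  have h1 := smoothStep_le_one (1 / 2) (3 / 4) (-s)
  by_cases hs : -1 ≤ s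
  · nlinarith
  · rw [smoothStep_of_ge (by norm_num) (by linarith)]; linarith

/-- `sat s = 0 ↔ s = 0`. [folklore] -/
theorem sat_eq_zero_iff {s : ℝ} : sat s = 0 ↔ s = 0 := by
  constructor
  · intro h
    rcases lt_trichotomy s 0 with hs | hs | hs
    · exact absurd h (sat_neg hs).ne
    · exact hs
    · exact absurd h (sat_pos hs).ne'
  · rintro rfl
    exact sat_of_abs_le (by norm_num)

/-- `0 ≤ sat s ↔ 0 ≤ s`. [folklore] -/
theorem sat_nonneg_iff {s : ℝ} : 0 ≤ sat s ↔ 0 ≤ s := by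
  constructor
  · intro h
    by_contra hs
    exact absurd h (not_le.mpr (sat_neg (not_le.mp hs)))
  · intro h
    rcases h.lt_or_eq with hs | hs
    · exact (sat_pos hs).le
    · rw [← hs, sat_eq_zero_iff.mpr rfl]

/-- `|sat s| ≤ 1`… we only need `|sat s / 2| ≤ 1/2`: `sat` takes values in `[-1, 1]`. [folklore] -/
theorem abs_sat_le (s : ℝ) : |sat s| ≤ 1 := by
  rw [abs_le]
  have hU0 := smoothStep_nonneg (1 / 2) (3 / 4) s
  have hU1 := smoothStep_le_one (1 / 2) (3 / 4) s
  have hL0 := smoothStep_nonneg (1 / 2) (3 / 4) (-s)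
  have hL1 := smoothStep_le_one (1 / 2) (3 / 4) (-s)
  rcases le_or_gt 0 s with hs | hs
  · rw [sat, smoothStep_of_le (a := 1 / 2) (by norm_num) (by linarith : -s ≤ 1 / 2), mul_zero,
      add_zero]
    by_cases h1 : s ≤ 1
    · constructor <;> nlinarith
    · rw [smoothStep_of_ge (by norm_num) (by linarith)]; constructor <;> linarith
  · rw [sat, smoothStep_of_le (a := 1 / 2) (by norm_num) (by linarith : s ≤ 1 / 2), mul_zero,
      add_zero]
    by_cases h1 : -1 ≤ s
    · constructor <;> nlinarith
    · rw [smoothStep_of_ge (by norm_num) (by linarith)]; constructor <;> linarith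

namespace SeifertDatum

open scoped Classical

variable {K : Knot} (D : SeifertDatum K)

/-! ### Points of `Λ` in the unit tube -/

/-- **A point of `Λ` in the open unit tube is `ν (x, s v)` with `|s| < 1`**, and
`s = ⟪fib, v⟫`. [folklore] -/
theorem exists_eq_apply_smul (p : D.Sheet) (h : p.1 ∈ D.tubeSet 1) :
    ∃ (x : 𝕊 1) (s : ℝ), |s| < 1 ∧ p.1 = D.ν (x, s • (D.v : 𝔼 2)) ∧
      D.fib p.1 = s • (D.v : 𝔼 2) ∧ ⟪D.fib p.1, (D.v : 𝔼 2)⟫ = s := by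
  obtain ⟨⟨x, w⟩, ⟨-, hw⟩, hxw⟩ := h
  have hw1 : ‖w‖ < 1 := by simpa using hw
  have hmem : D.ν (x, w) ∈ D.sheet := by rw [hxw]; exact p.2
  rw [D.apply_mem_sheet_iff x hw1.le] at hmem
  have hw' := eq_inner_smul_of_inner_quarterRot_eq_zero D.norm_v hmem
  set s := ⟪w, (D.v : 𝔼 2)⟫ with hs
  have hns : ‖w‖ = |s| := by rw [hw', norm_smul, D.norm_v, mul_one, Real.norm_eq_abs]
  refine ⟨x, s, by rwa [← hns], ?_, ?_, ?_⟩
  · rw [← hxw, ← hw']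
  · rw [← hxw, fib_apply, ← hw']
  · rw [← hxw, fib_apply]

/-- `ν (x, s v)` lies on `Λ` when `|s| ≤ 1`. [folklore] -/
theorem apply_smul_mem_sheet (x : 𝕊 1) {s : ℝ} (hs : |s| ≤ 1) :
    D.ν (x, s • (D.v : 𝔼 2)) ∈ D.sheet := by
  rw [D.apply_mem_sheet_iff x (by rw [norm_smul, D.norm_v, mul_one, Real.norm_eq_abs]; exact hs)]
  exact (inner_smul_unit D.norm_v s).2

/-- For `0 < |s| ≤ 1`, `θ (ν (x, s v)) = (s / |s|) v`, so `⟪θ (ν (x, s v)), v⟫ = s / |s|`.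
[folklore] -/
theorem inner_θhat_apply_smul (x : 𝕊 1) {s : ℝ} (hs0 : s ≠ 0) (hs : |s| ≤ 1) :
    ⟪D.θhat (D.ν (x, s • (D.v : 𝔼 2))), (D.v : 𝔼 2)⟫ = |s|⁻¹ * s := by
  have hw : s • (D.v : 𝔼 2) ≠ 0 := smul_ne_zero hs0 D.v_ne_zero
  have hn : ‖s • (D.v : 𝔼 2)‖ = |s| := by rw [norm_smul, D.norm_v, mul_one, Real.norm_eq_abs]
  rw [D.θhat_tube x hw (by rw [hn]; exact hs), hn, smul_smul, real_inner_smul_left,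
    real_inner_self_eq_norm_sq, D.norm_v]
  ring

/-- For `0 < s ≤ 1`, `θ (ν (x, s v)) = v`. [folklore] -/
theorem θhat_apply_smul_of_pos (x : 𝕊 1) {s : ℝ} (hs0 : 0 < s) (hs : s ≤ 1) :
    D.θhat (D.ν (x, s • (D.v : 𝔼 2))) = (D.v : 𝔼 2) := by
  have hw : s • (D.v : 𝔼 2) ≠ 0 := smul_ne_zero hs0.ne' D.v_ne_zero
  have hn : ‖s • (D.v : 𝔼 2)‖ = s := by
    rw [norm_smul, D.norm_v, mul_one, Real.norm_eq_abs, abs_of_pos hs0]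
  rw [D.θhat_tube x hw (by rw [hn]; exact hs), hn, smul_smul, inv_mul_cancel₀ hs0.ne', one_smul]

/-! ### The side function `τ` on `Λ` -/

/-- **The side function** `τ : Λ → ℝ`: `-sat ⟪w, v⟫` in the open unit tube, and `∓1` on the
sheets `θ⁻¹{±v}` outside it; `{τ ≤ 0} = K ∪ θ⁻¹{v}` and `{τ = 0} = K`. [folklore] -/
def sideFn (p : D.Sheet) : ℝ :=
  if p.1 ∈ D.tubeSet 1 then -sat ⟪D.fib p.1, (D.v : 𝔼 2)⟫
  else if 0 < ⟪D.θhat p.1, (D.v : 𝔼 2)⟫ then -1 else 1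

/-- `τ` at a tube point `ν (x, s v)`, `|s| < 1`, is `-sat s`. [folklore] -/
theorem sideFn_of_mem_tubeSet {p : D.Sheet} (h : p.1 ∈ D.tubeSet 1) :
    D.sideFn p = -sat ⟪D.fib p.1, (D.v : 𝔼 2)⟫ := if_pos h

/-- `τ` off the unit tube is `-1` where `⟪θ, v⟫ > 0`. [folklore] -/
theorem sideFn_of_not_mem_of_pos {p : D.Sheet} (h : p.1 ∉ D.tubeSet 1)
    (hp : 0 < ⟪D.θhat p.1, (D.v : 𝔼 2)⟫) : D.sideFn p = -1 := by
  rw [sideFn, if_neg h, if_pos hp]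

/-- `τ` off the unit tube is `1` where `⟪θ, v⟫ ≤ 0`. [folklore] -/
theorem sideFn_of_not_mem_of_not_pos {p : D.Sheet} (h : p.1 ∉ D.tubeSet 1)
    (hp : ¬ 0 < ⟪D.θhat p.1, (D.v : 𝔼 2)⟫) : D.sideFn p = 1 := by
  rw [sideFn, if_neg h, if_neg hp]

/-- Off the unit tube a point of `Λ` is not on the knot and `θ = ±v` there. [folklore] -/
theorem θhat_eq_or_of_not_mem_tubeSet (p : D.Sheet) (h : p.1 ∉ D.tubeSet 1) :
    p.1 ∉ range ⇑K ∧ (D.θhat p.1 = (D.v : 𝔼 2) ∨ D.θhat p.1 = -(D.v : 𝔼 2)) := by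
  have hK : p.1 ∉ range ⇑K := fun hK => h (D.range_K_subset_tubeSet one_pos hK)
  refine ⟨hK, ?_⟩
  rcases p.2 with h' | h' | h'
  · exact absurd h' hK
  · exact Or.inl h'
  · exact Or.inr h'

/-- **`{τ = 0}` is the knot.** [folklore] -/
theorem sideFn_eq_zero_iff (p : D.Sheet) : D.sideFn p = 0 ↔ p.1 ∈ range ⇑K := by
  by_cases h : p.1 ∈ D.tubeSet 1
  · obtain ⟨x, s, hs1, hps, -, hin⟩ := D.exists_eq_apply_smul p h
    rw [D.sideFn_of_mem_tubeSet h, hin, neg_eq_zero, sat_eq_zero_iff, hps]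
    constructor
    · rintro rfl
      rw [zero_smul, D.ν.coe_apply_zero]
      exact mem_range_self x
    · intro hK
      have h0 : s • (D.v : 𝔼 2) = 0 :=
        (D.ν.toTubeNbhd.apply_mem_range_iff (u := x) (w := s • (D.v : 𝔼 2))).mp hK
      exact (smul_eq_zero.mp h0).resolve_right D.v_ne_zero
  · obtain ⟨hK, -⟩ := D.θhat_eq_or_of_not_mem_tubeSet p h
    simp only [hK, iff_false]
    by_cases hp : 0 < ⟪D.θhat p.1, (D.v : 𝔼 2)⟫
    · rw [D.sideFn_of_not_mem_of_pos h hp]; norm_num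
    · rw [D.sideFn_of_not_mem_of_not_pos h hp]; norm_num

/-- **`{τ ≤ 0}` is `K ∪ θ⁻¹{v}`.** [folklore] -/
theorem sideFn_nonpos_iff (p : D.Sheet) :
    D.sideFn p ≤ 0 ↔ p.1 ∈ range ⇑K ∨ D.θhat p.1 = (D.v : 𝔼 2) := by
  by_cases h : p.1 ∈ D.tubeSet 1
  · obtain ⟨x, s, hs1, hps, -, hin⟩ := D.exists_eq_apply_smul p h
    rw [D.sideFn_of_mem_tubeSet h, hin, neg_nonpos, sat_nonneg_iff, hps]
    constructor
    · intro hs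
      rcases hs.lt_or_eq with hs | hs
      · exact Or.inr (D.θhat_apply_smul_of_pos x hs (le_of_lt (abs_lt.mp hs1).2))
      · left; rw [← hs, zero_smul, D.ν.coe_apply_zero]; exact mem_range_self x
    · rintro (hK | hv)
      · have h0 : s • (D.v : 𝔼 2) = 0 :=
          (D.ν.toTubeNbhd.apply_mem_range_iff (u := x) (w := s • (D.v : 𝔼 2))).mp hK
        rw [(smul_eq_zero.mp h0).resolve_right D.v_ne_zero]
      · by_contra hs
        push Not at hs
        have key := D.inner_θhat_apply_smul x hs.ne hs1.le
        rw [hv, real_inner_self_eq_norm_sq, D.norm_v, abs_of_neg hs, one_pow] at key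
        have h2 : (-s)⁻¹ * s = -1 := by rw [inv_neg, neg_mul, inv_mul_cancel₀ hs.ne]
        linarith
  · obtain ⟨hK, hθ⟩ := D.θhat_eq_or_of_not_mem_tubeSet p h
    simp only [hK, false_or]
    by_cases hp : 0 < ⟪D.θhat p.1, (D.v : 𝔼 2)⟫
    · rw [D.sideFn_of_not_mem_of_pos h hp]
      refine ⟨fun _ => ?_, fun _ => by norm_num⟩
      rcases hθ with hθ | hθ
      · exact hθ
      · rw [hθ, inner_neg_left, real_inner_self_eq_norm_sq, D.norm_v] at hp; norm_num at hp
    · rw [D.sideFn_of_not_mem_of_not_pos h hp]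
      refine ⟨fun h1 => by norm_num at h1, fun hv => absurd ?_ hp⟩
      rw [hv, real_inner_self_eq_norm_sq, D.norm_v]; norm_num

/-! ### Smoothness of `τ` -/

/-- The open set `W₊ = (closed tube of radius 3/4)ᶜ ∩ {⟪θ, v⟫ > 0}`. [folklore] -/
def posSet' : Set (𝕊 3) :=
  (D.closedTubeSet (3 / 4))ᶜ ∩ (fun q => ⟪D.θhat q, (D.v : 𝔼 2)⟫) ⁻¹' Ioi 0

/-- The open set `W₋ = (closed tube of radius 3/4)ᶜ ∩ {⟪θ, v⟫ < 0}`. [folklore] -/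
def negSet' : Set (𝕊 3) :=
  (D.closedTubeSet (3 / 4))ᶜ ∩ (fun q => ⟪D.θhat q, (D.v : 𝔼 2)⟫) ⁻¹' Iio 0

/-- `⟪θ, v⟫` is continuous off the closed tube of radius `3/4`. [folklore] -/
theorem continuousOn_inner_θhat' :
    ContinuousOn (fun q => ⟪D.θhat q, (D.v : 𝔼 2)⟫) (D.closedTubeSet (3 / 4))ᶜ := by
  have hsub : (D.closedTubeSet (3 / 4))ᶜ ⊆ (range ⇑K)ᶜ := by
    refine compl_subset_compl.mpr ?_
    rintro _ ⟨x, rfl⟩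
    rw [← D.ν.coe_apply_zero x, apply_mem_closedTubeSet_iff, norm_zero]
    norm_num
  exact (D.continuousOn_θhat.mono hsub).inner continuousOn_const

/-- `W₊` is open. [folklore] -/
theorem isOpen_posSet' : IsOpen D.posSet' :=
  D.continuousOn_inner_θhat'.isOpen_inter_preimage (D.isClosed_closedTubeSet _).isOpen_compl
    isOpen_Ioi

/-- `W₋` is open. [folklore] -/
theorem isOpen_negSet' : IsOpen D.negSet' :=
  D.continuousOn_inner_θhat'.isOpen_inter_preimage (D.isClosed_closedTubeSet _).isOpen_compl
    isOpen_Iio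

/-- **On `Λ ∩ W₊`, `τ = -1`.** [folklore] -/
theorem sideFn_of_mem_posSet' {p : D.Sheet} (h : p.1 ∈ D.posSet') : D.sideFn p = -1 := by
  by_cases ht : p.1 ∈ D.tubeSet 1
  · obtain ⟨x, s, hs1, hps, -, hin⟩ := D.exists_eq_apply_smul p ht
    have hs34 : 3 / 4 < |s| := by
      have h1 : p.1 ∉ D.closedTubeSet (3 / 4) := h.1
      rw [hps, apply_mem_closedTubeSet_iff, norm_smul, D.norm_v, mul_one, Real.norm_eq_abs,
        not_le] at h1
      exact h1
    have hs0 : s ≠ 0 := by intro h0; rw [h0, abs_zero] at hs34; norm_num at hs34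
    have hpos : 0 < ⟪D.θhat p.1, (D.v : 𝔼 2)⟫ := h.2
    rw [hps, D.inner_θhat_apply_smul x hs0 hs1.le] at hpos
    have hs : 0 < s := by
      by_contra hs; push Not at hs
      have : |s|⁻¹ * s ≤ 0 := mul_nonpos_of_nonneg_of_nonpos (inv_nonneg.mpr (abs_nonneg s)) hs
      linarith
    rw [abs_of_pos hs] at hs34
    rw [D.sideFn_of_mem_tubeSet ht, hin, sat_of_ge hs34.le]
  · exact D.sideFn_of_not_mem_of_pos ht h.2

/-- **On `Λ ∩ W₋`, `τ = 1`.** [folklore] -/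
theorem sideFn_of_mem_negSet' {p : D.Sheet} (h : p.1 ∈ D.negSet') : D.sideFn p = 1 := by
  by_cases ht : p.1 ∈ D.tubeSet 1
  · obtain ⟨x, s, hs1, hps, -, hin⟩ := D.exists_eq_apply_smul p ht
    have hs34 : 3 / 4 < |s| := by
      have h1 : p.1 ∉ D.closedTubeSet (3 / 4) := h.1
      rw [hps, apply_mem_closedTubeSet_iff, norm_smul, D.norm_v, mul_one, Real.norm_eq_abs,
        not_le] at h1
      exact h1
    have hs0 : s ≠ 0 := by intro h0; rw [h0, abs_zero] at hs34; norm_num at hs34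
    have hneg : ⟪D.θhat p.1, (D.v : 𝔼 2)⟫ < 0 := h.2
    rw [hps, D.inner_θhat_apply_smul x hs0 hs1.le] at hneg
    have hs : s < 0 := by
      by_contra hs; push Not at hs
      have : 0 ≤ |s|⁻¹ * s := mul_nonneg (inv_nonneg.mpr (abs_nonneg s)) hs
      linarith
    rw [abs_of_neg hs] at hs34
    rw [D.sideFn_of_mem_tubeSet ht, hin, sat_of_le (by linarith)]
    norm_num
  · have hnp : ¬ 0 < ⟪D.θhat p.1, (D.v : 𝔼 2)⟫ := not_lt.mpr (le_of_lt h.2)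
    exact D.sideFn_of_not_mem_of_not_pos ht hnp

/-- **`τ` is smooth on `Λ`.** In the unit tube it is the smooth ambient function `-sat ⟪fib, v⟫`
composed with the inclusion; outside it is locally constant (`±1` on `Λ ∩ W∓`). [folklore] -/
theorem contMDiff_sideFn : ContMDiff (𝓡 2) 𝓘(ℝ, ℝ) ∞ D.sideFn := by
  intro p
  by_cases ht : p.1 ∈ D.tubeSet 1
  · set h : (𝕊 3) → ℝ := fun q => -sat ⟪D.fib q, (D.v : 𝔼 2)⟫ with hh
    have hhs : ContMDiffOn (𝓡 3) 𝓘(ℝ, ℝ) ∞ h (range ⇑D.ν) :=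
      ((contDiff_sat.comp (contDiff_id.inner ℝ contDiff_const)).neg.contMDiff).comp_contMDiffOn
        D.contMDiffOn_fib
    have hp : ContMDiffAt (𝓡 3) 𝓘(ℝ, ℝ) ∞ h p.1 :=
      hhs.contMDiffAt (D.isOpen_range_ν.mem_nhds (D.tubeSet_subset_range 1 ht))
    have hcomp : ContMDiffAt (𝓡 2) 𝓘(ℝ, ℝ) ∞ (h ∘ D.sheetIncl) p :=
      hp.comp p (D.contMDiff_sheetIncl p)
    refine hcomp.congr_of_eventuallyEq ?_
    have hopen : IsOpen (D.sheetIncl ⁻¹' D.tubeSet 1) :=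
      (D.isOpen_tubeSet 1).preimage D.contMDiff_sheetIncl.continuous
    filter_upwards [hopen.mem_nhds (show D.sheetIncl p ∈ D.tubeSet 1 from ht)] with q hq
    rw [comp_apply, hh, D.sheetIncl_apply]
    exact D.sideFn_of_mem_tubeSet hq
  · obtain ⟨hK, hθ⟩ := D.θhat_eq_or_of_not_mem_tubeSet p ht
    have h34 : p.1 ∉ D.closedTubeSet (3 / 4) := by
      intro h'
      obtain ⟨⟨x, w⟩, ⟨-, hw⟩, hxw⟩ := h'
      apply ht
      rw [← hxw, apply_mem_tubeSet_iff]
      have : ‖w‖ ≤ 3 / 4 := by simpa using hw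
      linarith
    rcases hθ with hv | hv
    · have hmem : p.1 ∈ D.posSet' := ⟨h34, by
        show 0 < ⟪D.θhat p.1, (D.v : 𝔼 2)⟫
        rw [hv, real_inner_self_eq_norm_sq, D.norm_v]; norm_num⟩
      refine (contMDiffAt_const (c := (-1 : ℝ))).congr_of_eventuallyEq ?_
      have hopen : IsOpen (D.sheetIncl ⁻¹' D.posSet') :=
        D.isOpen_posSet'.preimage D.contMDiff_sheetIncl.continuous
      filter_upwards [hopen.mem_nhds (show D.sheetIncl p ∈ D.posSet' from hmem)] with q hq
      exact D.sideFn_of_mem_posSet' hq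
    · have hmem : p.1 ∈ D.negSet' := ⟨h34, by
        show ⟪D.θhat p.1, (D.v : 𝔼 2)⟫ < 0
        rw [hv, inner_neg_left, real_inner_self_eq_norm_sq, D.norm_v]; norm_num⟩
      refine (contMDiffAt_const (c := (1 : ℝ))).congr_of_eventuallyEq ?_
      have hopen : IsOpen (D.sheetIncl ⁻¹' D.negSet') :=
        D.isOpen_negSet'.preimage D.contMDiff_sheetIncl.continuous
      filter_upwards [hopen.mem_nhds (show D.sheetIncl p ∈ D.negSet' from hmem)] with q hq
      exact D.sideFn_of_mem_negSet' hq

/-! ### Regularity of `τ` along the knot -/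

/-- **The radial curve** `s ↦ ν (x, (sat s / 2) v)` through the knot point `K x`, with values
in `Λ` (`|sat s / 2| ≤ 1/2`), as a curve in the surface `Λ`. [folklore] -/
def radialCurve (x : 𝕊 1) : ℝ → D.Sheet :=
  D.toSheet (fun s => D.ν (x, (sat s / 2) • (D.v : 𝔼 2))) fun s =>
    D.apply_smul_mem_sheet x (by
      rw [abs_div, abs_of_pos (by norm_num : (0 : ℝ) < 2)]
      linarith [abs_sat_le s])

/-- The radial curve is smooth. [folklore] -/
theorem contMDiff_radialCurve (x : 𝕊 1) : ContMDiff 𝓘(ℝ, ℝ) (𝓡 2) ∞ (D.radialCurve x) := by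
  refine D.contMDiff_toSheet _ ?_
  have h2 : ContMDiff 𝓘(ℝ, ℝ) 𝓘(ℝ, 𝔼 2) ∞ fun s : ℝ => (sat s / 2) • (D.v : 𝔼 2) :=
    ((contDiff_sat.div_const 2).smul contDiff_const).contMDiff
  exact D.ν.contMDiff.comp (contMDiff_const.prodMk h2)

/-- Along the radial curve, `τ (γ s) = -s / 2` for `|s| ≤ 1/2`. [folklore] -/
theorem sideFn_radialCurve {x : 𝕊 1} {s : ℝ} (hs : |s| ≤ 1 / 2) :
    D.sideFn (D.radialCurve x s) = -(s / 2) := by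
  have hsat : sat s = s := sat_of_abs_le hs
  have hmem : (D.radialCurve x s).1 ∈ D.tubeSet 1 := by
    show D.ν (x, (sat s / 2) • (D.v : 𝔼 2)) ∈ D.tubeSet 1
    rw [apply_mem_tubeSet_iff, norm_smul, D.norm_v, mul_one, Real.norm_eq_abs, hsat, abs_div,
      abs_of_pos (by norm_num : (0 : ℝ) < 2)]
    linarith
  rw [D.sideFn_of_mem_tubeSet hmem]
  show -sat ⟪D.fib (D.ν (x, (sat s / 2) • (D.v : 𝔼 2))), (D.v : 𝔼 2)⟫ = -(s / 2)
  rw [fib_apply, (inner_smul_unit D.norm_v _).1, hsat, sat_of_abs_le]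
  rw [abs_div, abs_of_pos (by norm_num : (0 : ℝ) < 2)]
  linarith

/-- **`0` is a regular value of `τ`**: at a point of `Λ` on the knot, `dτ ≠ 0` — along the
radial curve `τ` is `s ↦ -s/2`, whose derivative is `-1/2`. [folklore] -/
theorem not_isMCriticalPt_sideFn (p : D.Sheet) (hp : D.sideFn p = 0) :
    ¬ IsMCriticalPt (𝓡 2) D.sideFn p := by
  intro hcrit
  obtain ⟨x, hx⟩ : p.1 ∈ range ⇑K := (D.sideFn_eq_zero_iff p).mp hp
  -- `p = γ 0`
  have hγ0 : D.radialCurve x 0 = p := by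
    apply Subtype.ext
    show D.ν (x, (sat 0 / 2) • (D.v : 𝔼 2)) = p.1
    rw [sat_eq_zero_iff.mpr rfl, zero_div, zero_smul, D.ν.coe_apply_zero, hx]
  have hγd : MDifferentiableAt 𝓘(ℝ, ℝ) (𝓡 2) (D.radialCurve x) 0 :=
    (D.contMDiff_radialCurve x 0).mdifferentiableAt (by simp)
  have hτd : MDifferentiableAt (𝓡 2) 𝓘(ℝ, ℝ) D.sideFn (D.radialCurve x 0) :=
    (D.contMDiff_sideFn _).mdifferentiableAt (by simp)
  -- the composite has vanishing derivative …
  have hA : mfderiv 𝓘(ℝ, ℝ) 𝓘(ℝ, ℝ) (D.sideFn ∘ D.radialCurve x) 0 (1 : ℝ) = 0 := by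
    rw [mfderiv_comp 0 hτd hγd]
    have : mfderiv (𝓡 2) 𝓘(ℝ, ℝ) D.sideFn (D.radialCurve x 0) = 0 := by rw [hγ0]; exact hcrit
    rw [this]
    rfl
  -- … but equals `s ↦ -s/2` near `0`
  have heq : (D.sideFn ∘ D.radialCurve x) =ᶠ[𝓝 0] fun s : ℝ => -(s / 2) := by
    have hI : Ioo (-(1 / 2) : ℝ) (1 / 2) ∈ 𝓝 (0 : ℝ) := Ioo_mem_nhds (by norm_num) (by norm_num)
    filter_upwards [hI] with s hs
    exact D.sideFn_radialCurve (abs_le.mpr ⟨hs.1.le, hs.2.le⟩)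
  have hB : (mfderiv 𝓘(ℝ, ℝ) 𝓘(ℝ, ℝ) (fun s : ℝ => -(s / 2)) 0 (1 : ℝ) : ℝ) = -(1 / 2 : ℝ) := by
    rw [mfderiv_eq_fderiv]
    show deriv (fun s : ℝ => -(s / 2)) 0 = -(1 / 2 : ℝ)
    exact (((hasDerivAt_id (0 : ℝ)).div_const 2).neg).deriv
  have hAB := congrFun (congrArg DFunLike.coe
    (heq.mfderiv_eq (I := 𝓘(ℝ, ℝ)) (I' := 𝓘(ℝ, ℝ)))) (1 : ℝ)
  have : (-(1 / 2) : ℝ) = 0 := hB.symm.trans (hAB.symm.trans hA)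
  norm_num at this

end SeifertDatum

namespace SeifertDatum

open scoped Classical

variable {K : Knot} (D : SeifertDatum K)

/-! ### The Seifert surface `Ŝ = {τ ≤ 0} = K ∪ θ⁻¹{v}` -/

/-- The charts of `Λ`, at the model `ℝ^(1+1)` (the form consumed by `sublevelAtlas'`).
[folklore] -/
instance instChartedSpaceSheet' : ChartedSpace (𝔼 (1 + 1)) D.Sheet := Sheet.instChartedSpace D

/-- The smooth structure of `Λ`, at the model `𝓡 (1 + 1)`. [folklore] -/
instance instIsManifoldSheet' : IsManifold (𝓡 (1 + 1)) ∞ D.Sheet := Sheet.instIsManifold D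

/-- The underlying subset `{τ ≤ 0}` of `Λ`. [folklore] -/
def surfaceSet : Set D.Sheet := D.sideFn ⁻¹' Iic 0

/-- Membership in `{τ ≤ 0}`. [folklore] -/
theorem mem_surfaceSet_iff (p : D.Sheet) : p ∈ D.surfaceSet ↔ D.sideFn p ≤ 0 := Iff.rfl

/-- **`{τ ≤ 0}` is `K ∪ θ⁻¹{v}`** (as points of `𝕊³`). [folklore] -/
theorem mem_surfaceSet_iff' (p : D.Sheet) :
    p ∈ D.surfaceSet ↔ p.1 ∈ range ⇑K ∨ D.θhat p.1 = (D.v : 𝔼 2) :=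
  D.sideFn_nonpos_iff p

/-- **The half-slice atlas of `Ŝ`**: `{τ ≤ 0}` is a regular sublevel set of the smooth
function `τ` on the surface `Λ` without boundary (`sublevelAtlas'`, Milnor 1963, Thm. 3.1).
[cite: Milnor1963, Thm. 3.1] -/
def surfaceAtlas : HalfSliceAtlas (𝓡 2) D.surfaceSet :=
  sublevelAtlas' (k := 1) D.contMDiff_sideFn 0 fun p hp => D.not_isMCriticalPt_sideFn p hp

/-- **The Seifert surface `Ŝ = K ∪ θ⁻¹{v}` as a type**: a compact `C^∞` surface with boundary
(charts in `EuclideanHalfSpace 2`, model `𝓡∂ 2`) whose boundary is the knot (Juhász 2023,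
proof of Prop. 4.10). [cite: Juhasz2023, proof of Prop. 4.10] -/
def Surface (D : SeifertDatum K) : Type := ↥D.surfaceSet

namespace Surface

/-- The subspace topology of `Ŝ ⊆ Λ`. [folklore] -/
instance instTopologicalSpace : TopologicalSpace D.Surface :=
  inferInstanceAs (TopologicalSpace ↥D.surfaceSet)

/-- `Ŝ` is Hausdorff. [folklore] -/
instance instT2Space : T2Space D.Surface := inferInstanceAs (T2Space ↥D.surfaceSet)

/-- `Ŝ` is second countable. [folklore] -/
instance instSecondCountableTopology : SecondCountableTopology D.Surface :=
  inferInstanceAs (SecondCountableTopology ↥D.surfaceSet)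

/-- **The smooth structure of `Ŝ`, charts** (`HalfSliceAtlas.chartedSpace` of `surfaceAtlas`).
[cite: Milnor1963, Thm. 3.1] -/
instance instChartedSpace : ChartedSpace (ℍ 2) D.Surface := D.surfaceAtlas.chartedSpace

/-- **The smooth structure of `Ŝ`, compatibility** (`HalfSliceAtlas.isManifold`).
[cite: Milnor1963, Thm. 3.1] -/
instance instIsManifold : IsManifold (𝓡∂ 2) ∞ D.Surface := D.surfaceAtlas.isManifold

end Surface

/-- The inclusion `Ŝ → Λ`. [folklore] -/
def surfIncl : D.Surface → D.Sheet := Subtype.val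

/-- The inclusion `Ŝ → Λ` is the subtype coercion (definitional). [folklore] -/
@[simp] theorem surfIncl_apply (p : D.Surface) : D.surfIncl p = p.1 := rfl

/-- The inclusion `Ŝ → 𝕊³`. [folklore] -/
def surfToSphere (p : D.Surface) : 𝕊 3 := p.1.1

/-- `surfToSphere = sheetIncl ∘ surfIncl` (definitional). [folklore] -/
theorem surfToSphere_eq : D.surfToSphere = D.sheetIncl ∘ D.surfIncl := rfl

/-- The inclusion `Ŝ → 𝕊³` is injective. [folklore] -/
theorem surfToSphere_injective : Injective D.surfToSphere :=
  Subtype.val_injective.comp Subtype.val_injective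

/-- **The inclusion `Ŝ ↪ Λ` is a smooth embedding** (`HalfSliceAtlas.isSmoothEmbedding_subtype_val'`).
[cite: Milnor1963, Thm. 3.1] -/
theorem isSmoothEmbedding_surfIncl :
    Manifold.IsSmoothEmbedding (𝓡∂ 2) (𝓡 2) ∞ D.surfIncl :=
  D.surfaceAtlas.isSmoothEmbedding_subtype_val'

/-- The inclusion `Ŝ ↪ Λ` is an immersion. [cite: Milnor1963, Thm. 3.1] -/
theorem isImmersion_surfIncl : Manifold.IsImmersion (𝓡∂ 2) (𝓡 2) ∞ D.surfIncl :=
  D.surfaceAtlas.isImmersion_subtype_val'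

/-- The inclusion `Ŝ ↪ Λ` is smooth. [cite: Milnor1963, Thm. 3.1] -/
theorem contMDiff_surfIncl : ContMDiff (𝓡∂ 2) (𝓡 2) ∞ D.surfIncl :=
  D.surfaceAtlas.contMDiff_subtype_val'

/-- The inclusion `Ŝ → 𝕊³` is smooth. [folklore] -/
theorem contMDiff_surfToSphere : ContMDiff (𝓡∂ 2) (𝓡 3) ∞ D.surfToSphere :=
  D.contMDiff_sheetIncl.comp D.contMDiff_surfIncl

/-- The inclusion `Ŝ → 𝕊³` is continuous. [folklore] -/
theorem continuous_surfToSphere : Continuous D.surfToSphere :=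
  continuous_subtype_val.comp continuous_subtype_val

/-- The inclusion `Ŝ → 𝕊³` is a topological embedding. [folklore] -/
theorem isEmbedding_surfToSphere : Topology.IsEmbedding D.surfToSphere :=
  Topology.IsEmbedding.subtypeVal.comp Topology.IsEmbedding.subtypeVal

/-! ### The boundary of `Ŝ` is the knot -/

/-- **Boundary points of `Ŝ` are the points of `{τ = 0}`** (`isBoundaryPoint_sublevel'_iff`).
[cite: Milnor1963, Thm. 3.1] -/
theorem isBoundaryPoint_iff (p : D.Surface) :
    (𝓡∂ 2).IsBoundaryPoint p ↔ D.sideFn p.1 = 0 :=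
  isBoundaryPoint_sublevel'_iff (k := 1) D.contMDiff_sideFn 0
    (fun p hp => D.not_isMCriticalPt_sideFn p hp) p

/-- **The boundary of `Ŝ` is the knot**: `p ∈ ∂Ŝ ↔ p ∈ K` (as a point of `𝕊³`).
[cite: Juhasz2023, proof of Prop. 4.10] -/
theorem isBoundaryPoint_iff_mem_range (p : D.Surface) :
    (𝓡∂ 2).IsBoundaryPoint p ↔ D.surfToSphere p ∈ range ⇑K := by
  rw [D.isBoundaryPoint_iff, D.sideFn_eq_zero_iff]; rfl

/-- The boundary of `Ŝ` as a set. [folklore] -/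
theorem boundary_eq : (𝓡∂ 2).boundary D.Surface = D.surfToSphere ⁻¹' range ⇑K := by
  ext p
  exact D.isBoundaryPoint_iff_mem_range p

/-- The knot point `K x` as a point of `Ŝ`. [folklore] -/
def knotPt (x : 𝕊 1) : D.Surface :=
  ⟨⟨K x, D.range_K_subset_sheet (mem_range_self x)⟩,
    (D.mem_surfaceSet_iff' _).mpr (Or.inl (mem_range_self x))⟩

/-- `knotPt x` is `K x` as a point of `𝕊³` (definitional). [folklore] -/
@[simp] theorem surfToSphere_knotPt (x : 𝕊 1) : D.surfToSphere (D.knotPt x) = K x := rfl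

/-- `knotPt` is continuous. [folklore] -/
theorem continuous_knotPt : Continuous D.knotPt :=
  (K.continuous.subtype_mk _).subtype_mk _

/-- Knot points are boundary points of `Ŝ`. [folklore] -/
theorem knotPt_mem_boundary (x : 𝕊 1) : D.knotPt x ∈ (𝓡∂ 2).boundary D.Surface := by
  rw [boundary_eq]; exact mem_range_self x

/-- **The boundary of `Ŝ` is homeomorphic to the circle**, by `K⁻¹` (the knot is an embedding
of `𝕊¹`). [cite: Juhasz2023, proof of Prop. 4.10] -/
def boundaryHomeomorph : ↥((𝓡∂ 2).boundary D.Surface) ≃ₜ (𝕊 1) where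
  toFun b := K.isSmoothEmbedding.isEmbedding.toHomeomorph.symm
    ⟨D.surfToSphere b.1, (D.isBoundaryPoint_iff_mem_range b.1).mp b.2⟩
  invFun x := ⟨D.knotPt x, D.knotPt_mem_boundary x⟩
  left_inv b := by
    apply Subtype.ext
    apply D.surfToSphere_injective
    have h := K.isSmoothEmbedding.isEmbedding.toHomeomorph.apply_symm_apply
      ⟨D.surfToSphere b.1, (D.isBoundaryPoint_iff_mem_range b.1).mp b.2⟩
    have h' := congrArg Subtype.val h
    exact h'
  right_inv x := by
    show K.isSmoothEmbedding.isEmbedding.toHomeomorph.symm ⟨K x, _⟩ = x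
    have : (⟨K x, (D.isBoundaryPoint_iff_mem_range (D.knotPt x)).mp (D.knotPt_mem_boundary x)⟩ :
        ↥(range ⇑K)) = K.isSmoothEmbedding.isEmbedding.toHomeomorph x := rfl
    rw [this, Homeomorph.symm_apply_apply]
  continuous_toFun :=
    K.isSmoothEmbedding.isEmbedding.toHomeomorph.symm.continuous.comp
      ((D.continuous_surfToSphere.comp continuous_subtype_val).subtype_mk _)
  continuous_invFun := D.continuous_knotPt.subtype_mk _

/-- **On the boundary, the inclusion is the knot composed with the boundary homeomorphism**:
`incl b = K (e b)`. [cite: Juhasz2023, proof of Prop. 4.10] -/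
theorem surfToSphere_eq_apply_boundaryHomeomorph (b : ↥((𝓡∂ 2).boundary D.Surface)) :
    D.surfToSphere b.1 = K (D.boundaryHomeomorph b) := by
  have h := K.isSmoothEmbedding.isEmbedding.toHomeomorph.apply_symm_apply
    ⟨D.surfToSphere b.1, (D.isBoundaryPoint_iff_mem_range b.1).mp b.2⟩
  exact (congrArg Subtype.val h).symm

/-! ### Compactness of `Ŝ` -/

/-- **The image of `Ŝ` in `𝕊³` is `K ∪ θ⁻¹{v}`.** [folklore] -/
theorem range_surfToSphere :
    range D.surfToSphere = range ⇑K ∪ {q | ∃ h : q ∉ range ⇑K, ((D.θ ⟨q, h⟩ : 𝕊 1) : 𝔼 2) = D.v} := by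
  ext q
  constructor
  · rintro ⟨p, rfl⟩
    rcases (D.mem_surfaceSet_iff' p.1).mp p.2 with h | h
    · exact Or.inl h
    · by_cases hK : D.surfToSphere p ∈ range ⇑K
      · exact Or.inl hK
      · right
        refine ⟨hK, ?_⟩
        rw [← D.θhat_of_not_mem hK]
        exact h
  · rintro (h | ⟨hK, h⟩)
    · obtain ⟨x, rfl⟩ := h
      exact ⟨D.knotPt x, rfl⟩
    · have hq : q ∈ D.sheet := Or.inr (Or.inl (by rw [D.θhat_of_not_mem hK]; exact h))
      refine ⟨⟨⟨q, hq⟩, (D.mem_surfaceSet_iff' _).mpr (Or.inr ?_)⟩, rfl⟩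
      show D.θhat q = D.v
      rw [D.θhat_of_not_mem hK]; exact h

/-- **The image of `Ŝ` in `𝕊³` is closed**: `θ⁻¹{v}` is closed in the open knot complement,
so its closure in `𝕊³` adds at most points of the knot, which belong to the image anyway.
[folklore] -/
theorem isClosed_range_surfToSphere : IsClosed (range D.surfToSphere) := by
  haveI : Fact (Module.finrank ℝ (𝔼 2) = 1 + 1) := ⟨by simp⟩
  -- the closed subset `θ⁻¹{v}` of the knot complement
  set C : Set K.complement := {P | ((D.θ P : 𝕊 1) : 𝔼 2) = D.v} with hC
  have hCc : IsClosed C :=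
    isClosed_eq (continuous_subtype_val.comp D.contMDiff_θ.continuous) continuous_const
  obtain ⟨F, hF, hFC⟩ := (Topology.IsInducing.subtypeVal.isClosed_iff).mp hCc
  have key : range D.surfToSphere = range ⇑K ∪ F := by
    rw [D.range_surfToSphere]
    ext q
    simp only [mem_union, mem_setOf_eq]
    constructor
    · rintro (h | ⟨hK, h⟩)
      · exact Or.inl h
      · right
        have h2 : (⟨q, hK⟩ : K.complement) ∈ C := h
        rw [← hFC] at h2
        exact h2
    · rintro (h | hq)
      · exact Or.inl h
      · by_cases hK : q ∈ range ⇑K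
        · exact Or.inl hK
        · right
          refine ⟨hK, ?_⟩
          have h2 : (⟨q, hK⟩ : K.complement) ∈ C := by rw [← hFC]; exact hq
          exact h2
  rw [key]
  exact K.isClosed_range.union hF

/-- **`Ŝ` is compact.** [cite: Juhasz2023, proof of Prop. 4.10 ("compact")] -/
instance instCompactSpaceSurface : CompactSpace D.Surface := by
  rw [← isCompact_univ_iff, D.isEmbedding_surfToSphere.isCompact_iff, image_univ]
  exact D.isClosed_range_surfToSphere.isCompact

/-- `Ŝ` is nonempty: it contains the knot. [folklore] -/
instance instNonemptySurface : Nonempty D.Surface :=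
  ⟨D.knotPt ⟨EuclideanSpace.single 0 1, by simp⟩⟩

end SeifertDatum

namespace SeifertDatum

variable {K : Knot} (D : SeifertDatum K)

/-! ### The surface map `Ŝ → ℝ⁴` -/

/-- **The surface map** `F : Ŝ → ℝ⁴`, the inclusion `Ŝ ⊆ Λ ⊆ 𝕊³ ⊆ ℝ⁴`. [folklore] -/
def surfaceMap (p : D.Surface) : 𝔼 4 := ((D.surfToSphere p : 𝕊 3) : 𝔼 4)

/-- `F p` is `p` as a point of `ℝ⁴` (definitional). [folklore] -/
@[simp] theorem surfaceMap_apply (p : D.Surface) :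
    D.surfaceMap p = ((D.surfToSphere p : 𝕊 3) : 𝔼 4) := rfl

/-- `‖F p‖ = 1`: the surface lies in the unit sphere. [folklore] -/
theorem norm_surfaceMap (p : D.Surface) : ‖D.surfaceMap p‖ = 1 :=
  norm_eq_of_mem_sphere (D.surfToSphere p)

/-- `F` is injective. [folklore] -/
theorem surfaceMap_injective : Injective D.surfaceMap :=
  Subtype.val_injective.comp D.surfToSphere_injective

/-- **`F` is smooth** (for the manifold-with-boundary structure of `Ŝ`). [folklore] -/
theorem contMDiff_surfaceMap : ContMDiff (𝓡∂ 2) 𝓘(ℝ, 𝔼 4) ∞ D.surfaceMap := by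
  haveI : Fact (Module.finrank ℝ (𝔼 4) = 3 + 1) := ⟨by simp⟩
  exact (contMDiff_coe_sphere (E := 𝔼 4) (n := 3)).comp D.contMDiff_surfToSphere

/-- **`F` is an immersion, boundary points included**: its differential is injective at every
point, as the composite of the injective differentials of the inclusions `Ŝ ↪ Λ`
(`injective_mfderiv_of_isImmersionAt'`, also at boundary points), `Λ ↪ 𝕊³` and `𝕊³ ↪ ℝ⁴`
(`mfderiv_coe_sphere_injective`). [folklore] -/
theorem injective_mfderiv_surfaceMap (p : D.Surface) :
    Injective (mfderiv (𝓡∂ 2) 𝓘(ℝ, 𝔼 4) D.surfaceMap p) := by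
  haveI : Fact (Module.finrank ℝ (𝔼 4) = 3 + 1) := ⟨by simp⟩
  have h1 : Injective (mfderiv (𝓡∂ 2) (𝓡 2) D.surfIncl p) :=
    injective_mfderiv_of_isImmersionAt' (D.isImmersion_surfIncl.isImmersionAt p)
  have h2 : Injective (mfderiv (𝓡 2) (𝓡 3) D.sheetIncl (D.surfIncl p)) :=
    injective_mfderiv_of_isImmersionAt' (D.isImmersion_sheetIncl.isImmersionAt _)
  have h3 : Injective (mfderiv (𝓡 3) 𝓘(ℝ, 𝔼 4) (Subtype.val : (𝕊 3) → 𝔼 4)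
      (D.sheetIncl (D.surfIncl p))) :=
    mfderiv_coe_sphere_injective (n := 3) _
  have hd1 : MDifferentiableAt (𝓡∂ 2) (𝓡 2) D.surfIncl p :=
    (D.contMDiff_surfIncl p).mdifferentiableAt (by simp)
  have hd2 : MDifferentiableAt (𝓡 2) (𝓡 3) D.sheetIncl (D.surfIncl p) :=
    (D.contMDiff_sheetIncl _).mdifferentiableAt (by simp)
  have hd3 : MDifferentiableAt (𝓡 3) 𝓘(ℝ, 𝔼 4) (Subtype.val : (𝕊 3) → 𝔼 4)
      (D.sheetIncl (D.surfIncl p)) :=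
    (contMDiff_coe_sphere (D.sheetIncl (D.surfIncl p))).mdifferentiableAt one_ne_zero
  have hd32 : MDifferentiableAt (𝓡 2) 𝓘(ℝ, 𝔼 4) ((Subtype.val : (𝕊 3) → 𝔼 4) ∘ D.sheetIncl)
      (D.surfIncl p) := hd3.comp (D.surfIncl p) hd2
  have heq : D.surfaceMap = ((Subtype.val : (𝕊 3) → 𝔼 4) ∘ D.sheetIncl) ∘ D.surfIncl := rfl
  rw [heq, mfderiv_comp p hd32 hd1]
  intro a b hab
  apply h1
  have hab' : mfderiv (𝓡 2) 𝓘(ℝ, 𝔼 4) ((Subtype.val : (𝕊 3) → 𝔼 4) ∘ D.sheetIncl) (D.surfIncl p)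
      (mfderiv (𝓡∂ 2) (𝓡 2) D.surfIncl p a) =
      mfderiv (𝓡 2) 𝓘(ℝ, 𝔼 4) ((Subtype.val : (𝕊 3) → 𝔼 4) ∘ D.sheetIncl) (D.surfIncl p)
      (mfderiv (𝓡∂ 2) (𝓡 2) D.surfIncl p b) := hab
  rw [mfderiv_comp (D.surfIncl p) (f := D.sheetIncl) hd3 hd2] at hab'
  exact h2 (h3 hab')

/-- **On the boundary, `F = K ∘ e`** for the boundary homeomorphism `e : ∂Ŝ ≃ₜ 𝕊¹`.
[cite: Juhasz2023, proof of Prop. 4.10] -/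
theorem surfaceMap_boundary (b : ↥((𝓡∂ 2).boundary D.Surface)) :
    D.surfaceMap b.1 = ((K (D.boundaryHomeomorph b) : 𝕊 3) : 𝔼 4) := by
  rw [surfaceMap_apply, D.surfToSphere_eq_apply_boundaryHomeomorph b]

/-- **Interior points of `Ŝ` map off the knot**: `F p ∉ K(𝕊¹)` unless `p ∈ ∂Ŝ`. [folklore] -/
theorem surfToSphere_not_mem_range_of_isInteriorPoint {p : D.Surface}
    (hp : (𝓡∂ 2).IsInteriorPoint p) : D.surfToSphere p ∉ range ⇑K := by
  intro h
  have hb : (𝓡∂ 2).IsBoundaryPoint p := (D.isBoundaryPoint_iff_mem_range p).mpr h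
  exact (ModelWithCorners.isInteriorPoint_iff_not_isBoundaryPoint p).mp hp hb

end SeifertDatum

end Literature.Topology.FourManifolds
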